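import Summits.QuantumAdvantage.QuantumAdvantage.Theorems.CubicForrelationNearExactIsExactAmmCeilingX
import Summits.QuantumAdvantage.QuantumAdvantage.Theorems.NearExactIsExact.Negative.CornerFlatPluecker

/-!
# `NearExactIsExact` (stmt-QuantumAdvantage-14043), negative side — the frame-free parity lemma in the
# INTRINSIC coordinates of the almost-MM endgame (`Z = ∅`, parts X/V of `stub_ammCeiling`)

Negative-side support (disprover lane, unit `b2b-cforr-disprove-g33`, 2026-08-23).  HONEST FRAMING: VALUE = THEOREM —
NOT summit progress (the almost-MM class is capped by `stub_ammCeiling` already; this sharpens the picture inside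
its endgame regime).

Parts X/V of the almost-Maiorana–McFarland ceiling (`…AmmCeilingX`, `…AmmCeilingV`) describe a cubic `f` on
`a + (a+2)` bits fibrewise by the intrinsic data
`B(x₁)ᵢⱼ = f(x₁‖0) ⊕ f(x₁‖eᵢ) ⊕ f(x₁‖eⱼ) ⊕ f(x₁‖eᵢ⊕eⱼ)` (the polar / Plücker matrix, affine in `x₁`, `acx_deg_polar`)
and `d(x₁)ⱼ = f(x₁‖eⱼ) ⊕ f(x₁‖0)` (quadratic in `x₁`, `acx_deg_first`); where `B(x₁)_{pq} = 1` the slice is the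
corner flat with corners `c_{στ}(x₁) = d ⊕ B_p∗B_q ⊕ σB_p ⊕ τB_q` (rows `B_p, B_q` as a LOCAL frame), and part V
bounds the mismatch indicator only as a degree-`7` function (`acv_mismatch_many`: `≥ 2^a/128` fibres).

**`cfi_parity_deg`.**  For ANY pointwise choice of pivots `p(x₁), q(x₁)` with `B(x₁)_{p(x₁)q(x₁)} = 1`, the fibre
parity `x₁ ↦ ⊕_{στ} h(c_{στ}(x₁))` of a cubic `h` has degree `≤ 3`: the frame-free parity lemma
`cfp_parity_deg` needs no regularity of the frame, only that its Plücker vector — here `B(x₁)` itself, by the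
quadratic Plücker relations — is affine and that its twisted base point — here `d(x₁)` — is quadratic.  (The
pivots may jump from point to point; the parity is intrinsic anyway: it is the sum of `h` over the fibre.)
**`cfi_even_fibres_many`.**  Hence ONE fibre of even `h`-parity forces `≥ 2^{a-3}` of them (Reed–Muller,
`stub_rmWeight`).  Read through part V (`Γ(x₁) = (K/2)Σ_{στ}(−1)^{m_{στ}(x₁)}`, an even fibre has a mismatch, so
`Γ ≤ K` there): in the `Z = ∅` endgame either every fibre parity is odd — `g` is BENT — or
`Φ ≤ 1 − 2⁻⁴ = 15/16`, versus the `1 − 2⁻⁸` of the degree-`7` count.  Standard three axioms only.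
-/

set_option linter.dupNamespace false -- D-0017: single-problem summit ⇒ `QuantumAdvantage.QuantumAdvantage` by design

noncomputable section

namespace Summit.QuantumAdvantage.QuantumAdvantage.Theorems.NearExactIsExact.Negative.CornerFlatIntrinsic

open Finset
open Literature.Computability.QuantumComplexity
open Literature.Computability.QuantumComplexity.BuzetChailloux (bxor zeroVec)
open Summit.QuantumAdvantage.QuantumAdvantage.Theorems.CubicForrelation.NearExactIsExact
open Summit.QuantumAdvantage.QuantumAdvantage.Theorems.NearExactIsExact.Negative.CornerFlatPluecker (cfp_parity_deg)

variable {a : ℕ}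

/-- Solving the quadratic Plücker relation at a pivot: `B_{pq} = 1` and
`B_{pq}B_{ij} ⊕ B_{pi}B_{qj} ⊕ B_{pj}B_{qi} = 0` give `B_{ij} = B_{pi}B_{qj} ⊕ B_{pj}B_{qi}` — the rows `B_p, B_q`
have Plücker vector `B`. [cite: Carlet2020, §5.1] -/
theorem cfi_pluecker_solve : ∀ bpq bij bpi bqj bpj bqi : Bool, bpq = true →
    ((bpq && bij) ^^ (bpi && bqj) ^^ (bpj && bqi)) = false → ((bpi && bqj) ^^ (bpj && bqi)) = bij := by
  decide

/-- **Fibre parity is cubic, intrinsically.**  `f` cubic on `a + (a+2)` bits with polar matrix `B` and first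
differences `d` (hypotheses `hB`, `hd`), the quadratic Plücker relations `hPl`, a cubic `h`, and any pointwise
pivots `p q` with `B(x₁)_{p(x₁) q(x₁)} = 1`: the parity of `h` over the four local corners
`d ⊕ B_p∗B_q ⊕ σB_p ⊕ τB_q` has degree `≤ 3` in `x₁` (frame-free parity lemma `cfp_parity_deg` with
`u = B_{p(x₁)}`, `v = B_{q(x₁)}`, `b = d ⊕ B_p∗B_q`). [folklore] -/
theorem cfi_parity_deg {f : (Fin (a + (a + 2)) → Bool) → Bool} (hf : IsDegLeFun 3 f)
    {h : (Fin (a + 2) → Bool) → Bool} (hh : IsDegLeFun 3 h)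
    (B : (Fin a → Bool) → Fin (a + 2) → Fin (a + 2) → Bool) (d : (Fin a → Bool) → Fin (a + 2) → Bool)
    (hB : ∀ x₁ i j, B x₁ i j = (f (Fin.append x₁ zeroVec) ^^ f (Fin.append x₁ (Pi.single i true)) ^^
      f (Fin.append x₁ (Pi.single j true)) ^^ f (Fin.append x₁ (bxor (Pi.single i true) (Pi.single j true)))))
    (hd : ∀ x₁ j, d x₁ j = (f (Fin.append x₁ (Pi.single j true)) ^^ f (Fin.append x₁ zeroVec)))
    (hPl : ∀ x₁ i j i' j', ((B x₁ i j && B x₁ i' j') ^^ (B x₁ i i' && B x₁ j j') ^^ (B x₁ i j' && B x₁ j i')) = false)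
    (p q : (Fin a → Bool) → Fin (a + 2)) (hpq : ∀ x₁, B x₁ (p x₁) (q x₁) = true) :
    IsDegLeFun 3 (fun x₁ =>
      h (fun j => d x₁ j ^^ (B x₁ (p x₁) j && B x₁ (q x₁) j)) ^^
      h (bxor (fun j => d x₁ j ^^ (B x₁ (p x₁) j && B x₁ (q x₁) j)) (B x₁ (p x₁))) ^^
      h (bxor (fun j => d x₁ j ^^ (B x₁ (p x₁) j && B x₁ (q x₁) j)) (B x₁ (q x₁))) ^^
      h (bxor (fun j => d x₁ j ^^ (B x₁ (p x₁) j && B x₁ (q x₁) j)) (bxor (B x₁ (p x₁)) (B x₁ (q x₁))))) := by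
  have hBdeg : ∀ i j, IsDegLeFun 1 (fun x => B x i j) := fun i j =>
    rm_isDegLeFun_congr (acx_deg_polar hf (Pi.single i true) (Pi.single j true)) fun x => (hB x i j).symm
  have hddeg : ∀ j, IsDegLeFun 2 (fun x => d x j) := fun j =>
    rm_isDegLeFun_congr (acx_deg_first hf (Pi.single j true)) fun x => (hd x j).symm
  have hp : ∀ i j, IsDegLeFun 1 (fun x => (B x (p x) i && B x (q x) j) ^^ (B x (p x) j && B x (q x) i)) :=
    fun i j => rm_isDegLeFun_congr (hBdeg i j) fun x =>
      (cfi_pluecker_solve _ _ _ _ _ _ (hpq x) (hPl x (p x) (q x) i j)).symm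
  have hl : ∀ i, IsDegLeFun 2 (fun x => (d x i ^^ (B x (p x) i && B x (q x) i)) ^^ (B x (p x) i && B x (q x) i)) :=
    fun i => rm_isDegLeFun_congr (hddeg i) fun x => by
      cases d x i <;> cases (B x (p x) i && B x (q x) i) <;> rfl
  exact cfp_parity_deg (b := fun x j => d x j ^^ (B x (p x) j && B x (q x) j)) (u := fun x => B x (p x))
    (v := fun x => B x (q x)) hh hp hl

/-- **One even fibre forces `2^{a-3}` even fibres** (in the `Z = ∅` endgame of `stub_ammCeiling`): with the data of
`cfi_parity_deg`, if the `h`-parity of some fibre is even then at least `2^a / 8` fibres have even parity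
(Reed–Muller minimum weight `stub_rmWeight` on the cubic parity function).  Through part V's
`Γ(x₁) = (K/2)Σ_{στ}(−1)^{m_{στ}}` this reads: all fibre parities odd (`g` bent), or `Φ ≤ 15/16`. [folklore] -/
theorem cfi_even_fibres_many {f : (Fin (a + (a + 2)) → Bool) → Bool} (hf : IsDegLeFun 3 f)
    {h : (Fin (a + 2) → Bool) → Bool} (hh : IsDegLeFun 3 h)
    (B : (Fin a → Bool) → Fin (a + 2) → Fin (a + 2) → Bool) (d : (Fin a → Bool) → Fin (a + 2) → Bool)
    (hB : ∀ x₁ i j, B x₁ i j = (f (Fin.append x₁ zeroVec) ^^ f (Fin.append x₁ (Pi.single i true)) ^^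
      f (Fin.append x₁ (Pi.single j true)) ^^ f (Fin.append x₁ (bxor (Pi.single i true) (Pi.single j true)))))
    (hd : ∀ x₁ j, d x₁ j = (f (Fin.append x₁ (Pi.single j true)) ^^ f (Fin.append x₁ zeroVec)))
    (hPl : ∀ x₁ i j i' j', ((B x₁ i j && B x₁ i' j') ^^ (B x₁ i i' && B x₁ j j') ^^ (B x₁ i j' && B x₁ j i')) = false)
    (p q : (Fin a → Bool) → Fin (a + 2)) (hpq : ∀ x₁, B x₁ (p x₁) (q x₁) = true)
    (heven : ∃ x₀,
      (h (fun j => d x₀ j ^^ (B x₀ (p x₀) j && B x₀ (q x₀) j)) ^^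
        h (bxor (fun j => d x₀ j ^^ (B x₀ (p x₀) j && B x₀ (q x₀) j)) (B x₀ (p x₀))) ^^
        h (bxor (fun j => d x₀ j ^^ (B x₀ (p x₀) j && B x₀ (q x₀) j)) (B x₀ (q x₀))) ^^
        h (bxor (fun j => d x₀ j ^^ (B x₀ (p x₀) j && B x₀ (q x₀) j)) (bxor (B x₀ (p x₀)) (B x₀ (q x₀))))) = false) :
    2 ^ a ≤ 2 ^ 3 * (univ.filter fun x₁ : Fin a → Bool =>
      (h (fun j => d x₁ j ^^ (B x₁ (p x₁) j && B x₁ (q x₁) j)) ^^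
        h (bxor (fun j => d x₁ j ^^ (B x₁ (p x₁) j && B x₁ (q x₁) j)) (B x₁ (p x₁))) ^^
        h (bxor (fun j => d x₁ j ^^ (B x₁ (p x₁) j && B x₁ (q x₁) j)) (B x₁ (q x₁))) ^^
        h (bxor (fun j => d x₁ j ^^ (B x₁ (p x₁) j && B x₁ (q x₁) j)) (bxor (B x₁ (p x₁)) (B x₁ (q x₁))))) = false).card := by
  classical
  obtain ⟨x₀, hx₀⟩ := heven
  have hpar := cfi_parity_deg hf hh B d hB hd hPl p q hpq
  have hneg := fc_deg_bxor hpar (isDegLeFun_const 3 true)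
  have hcnt := stub_rmWeight stub_derivDegree a 3 _ hneg ⟨x₀, by simp only [hx₀]; rfl⟩
  refine hcnt.trans (Nat.mul_le_mul_left _ (card_le_card fun x hx => ?_))
  simp only [mem_filter, mem_univ, true_and] at hx ⊢
  revert hx
  cases (h (fun j => d x j ^^ (B x (p x) j && B x (q x) j)) ^^
        h (bxor (fun j => d x j ^^ (B x (p x) j && B x (q x) j)) (B x (p x))) ^^
        h (bxor (fun j => d x j ^^ (B x (p x) j && B x (q x) j)) (B x (q x))) ^^
        h (bxor (fun j => d x j ^^ (B x (p x) j && B x (q x) j)) (bxor (B x (p x)) (B x (q x))))) <;> simp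

end Summit.QuantumAdvantage.QuantumAdvantage.Theorems.NearExactIsExact.Negative.CornerFlatIntrinsic

end
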